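import Summits.QuantumFields.QCD.Theorems.SmallFieldUltracontractivity.Negative.Tightness
import Literature.Probability.LatticeModels.TorusFourierProofs
import Literature.MathematicalPhysics.QuantumLattice.WilsonFermionBlockAveraging
import Literature.MathematicalPhysics.QuantumLattice.HeatKernelGroupGaugeProofs

/-!
# Stub `stub_gaugeCovariance` of line `point-centred-axial-parabolic`
(crux `Summit.QuantumFields.QCD.Theses.HeatSlicedQuarks.SmallFieldUltracontractivity`, item stmt-QuantumFields-8871)

Gauge invariance of the colour-summed diagonal blocks of the Wilson heat kernel
`e^{-t D_Wᴴ D_W}` and of the plaquette characters (statement `GaugeCovariance`, S4a, of the line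
skeleton; tree vocabulary only: `SU3` is the abbreviation of
`Theorems/SmallFieldUltracontractivity/Negative/LoadBearing.lean`).

* `conjTranspose_gaugeRotation`: for a representation `ρ` by unitary matrices the gauge rotation
  `𝒢(g) = gaugeRotation ρ σ g` (block diagonal in the site, `ρ(g x) ⊗ 1_σ` on the block of the site
  `x`) satisfies `𝒢(g)ᴴ = 𝒢(g⁻¹)` (`= 𝒢(g)⁻¹` by `gaugeRotation_inv_mul`).
* `stub_gaugeCovariance`: with `D_W(g•U) = 𝒢 D_W(U) 𝒢(g⁻¹)` (`wilsonDirac_gaugeTransform`),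
  `H_{g•U} := D_W(g•U)ᴴ D_W(g•U) = 𝒢 H_U 𝒢(g⁻¹)`, hence `e^{-tH_{g•U}} = 𝒢 e^{-tH_U} 𝒢(g⁻¹)`
  (`Matrix.exp_units_conj`); restricted to the colour block at fixed site `x` and spin `α` this is
  conjugation by `ρ(g x)`, whose trace is invariant (`Matrix.trace_mul_cycle`).  The plaquette
  holonomy transforms by conjugation (`plaquetteHolonomy_gaugeTransform`), so its character is
  invariant as well.
-/

noncomputable section

namespace Summit.QuantumFields.QCD.Cruxes.SmallFieldUltracontractivity.PointCentredAxialParabolic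

open Literature.MathematicalPhysics.QuantumLattice Literature.MathematicalPhysics.QuantumFieldTheory
open Literature.Probability.LatticeModels (TorusSite torusChar)
open Summit.QuantumFields.QCD.Theorems.SmallFieldUltracontractivity.Negative
open scoped Matrix ComplexConjugate

/-- For a representation `ρ` by unitary matrices the gauge rotation matrix is unitary, with adjoint
`𝒢(g)ᴴ = 𝒢(g⁻¹)`: entrywise, `𝒢(g)` is `ρ(g x) ⊗ 1` on the diagonal block of the site `x` and
zero between different sites, and `(ρ(g x))ᴴ = ρ((g x)⁻¹)` (`star_rep_apply`). -/
theorem conjTranspose_gaugeRotation {X : Type*} [DecidableEq X] {G : Type*} [Group G] {N : ℕ}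
    (ρ : G →* Matrix (Fin N) (Fin N) ℂ) (hρ : ∀ h, ρ h ∈ Matrix.unitaryGroup (Fin N) ℂ)
    {σ : Type*} [DecidableEq σ] (g : X → G) :
    (gaugeRotation ρ σ g)ᴴ = gaugeRotation ρ σ g⁻¹ := by
  ext p q
  simp only [Matrix.conjTranspose_apply, gaugeRotation, Matrix.of_apply, Pi.inv_apply]
  by_cases h : p.1 = q.1
  · rw [if_pos h, if_pos h.symm, star_mul', star_rep_apply ρ hρ, h, Matrix.one_apply,
      Matrix.one_apply]
    by_cases h2 : p.2.2 = q.2.2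
    · rw [if_pos h2, if_pos h2.symm, star_one]
    · rw [if_neg h2, if_neg (Ne.symm h2), star_zero]
  · rw [if_neg h, if_neg (Ne.symm h), star_zero]

/-- **S4a `GaugeCovariance`.**  For every gauge transformation `g` of an `SU(3)` lattice gauge field
`U` on the four-torus: (1) at every site `x` and spin index `α` the colour-summed diagonal block
`Σ_a e^{-t H}((x,a,α),(x,a,α))` of the heat kernel of `H_U = D_W(U,m,1)ᴴ D_W(U,m,1)` is the same
for `U` and for `g • U` — because `D_W(g•U) = 𝒢 D_W(U) 𝒢⁻¹` with the unitary gauge rotation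
`𝒢 = gaugeRotation ρ (Fin 4) g`, so `e^{-tH_{g•U}} = 𝒢 e^{-tH_U} 𝒢⁻¹`, and on the `(x, ·, α)` colour
block `𝒢` acts as conjugation by `ρ(g x)`, which leaves the colour trace invariant; (2) every
plaquette character `tr ρ(U_p)` based at `x` is gauge invariant — the holonomy transforms as
`U_p ↦ g(x) U_p g(x)⁻¹` and the trace is cyclic. -/
theorem stub_gaugeCovariance :
    ∀ (L : ℕ) [NeZero L] (U : GaugeConfig 4 L SU3) (g : TorusSite 4 L → SU3) (m t : ℝ)
      (x : TorusSite 4 L),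
      (∀ α : Fin 4,
        ∑ a : Fin 3, (NormedSpace.exp (-(t : ℂ) •
            ((wilsonDirac (fundamentalRep (Fin 3)) (gaugeTransform g U) m 1)ᴴ *
              wilsonDirac (fundamentalRep (Fin 3)) (gaugeTransform g U) m 1))) (x, a, α) (x, a, α) =
        ∑ a : Fin 3, (NormedSpace.exp (-(t : ℂ) •
            ((wilsonDirac (fundamentalRep (Fin 3)) U m 1)ᴴ *
              wilsonDirac (fundamentalRep (Fin 3)) U m 1))) (x, a, α) (x, a, α)) ∧
      ∀ μ ν : Fin 4, ((fundamentalRep (Fin 3)) (plaquetteHolonomy (gaugeTransform g U) x μ ν)).trace =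
        ((fundamentalRep (Fin 3)) (plaquetteHolonomy U x μ ν)).trace := by
  intro L _ U g m t x
  set ρ : SU3 →* Matrix (Fin 3) (Fin 3) ℂ := fundamentalRep (Fin 3)
  have hρ : ∀ h, ρ h ∈ Matrix.unitaryGroup (Fin 3) ℂ := fundamentalRep_mem_unitaryGroup
  refine ⟨fun α => ?_, fun μ ν => ?_⟩
  · -- the gauge rotation `𝒢 = 𝒢(g)`, its inverse `𝒢' = 𝒢(g⁻¹) = 𝒢ᴴ`, and `D = D_W(U)`
    set 𝒢 := gaugeRotation ρ (Fin 4) g with h𝒢def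
    set 𝒢' := gaugeRotation ρ (Fin 4) g⁻¹ with h𝒢'def
    set D := wilsonDirac ρ U m 1
    have h1 : 𝒢' * 𝒢 = 1 := gaugeRotation_inv_mul ρ g
    have h2 : 𝒢 * 𝒢' = 1 := gaugeRotation_mul_inv ρ g
    have hH : 𝒢ᴴ = 𝒢' := conjTranspose_gaugeRotation ρ hρ g
    have hH' : 𝒢'ᴴ = 𝒢 := by rw [← hH, Matrix.conjTranspose_conjTranspose]
    have hD : wilsonDirac ρ (gaugeTransform g U) m 1 = 𝒢 * D * 𝒢' :=
      wilsonDirac_gaugeTransform ρ g U m 1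
    -- `H_{g•U} = 𝒢 H_U 𝒢'`
    have hHam : (𝒢 * D * 𝒢')ᴴ * (𝒢 * D * 𝒢') = 𝒢 * (Dᴴ * D) * 𝒢' := by
      rw [Matrix.conjTranspose_mul, Matrix.conjTranspose_mul, hH, hH']
      simp only [Matrix.mul_assoc]
      rw [← Matrix.mul_assoc 𝒢' 𝒢, h1, Matrix.one_mul]
    -- `exp` commutes with conjugation by the unit `𝒢` (two-sided inverse `𝒢'`)
    have hexp : NormedSpace.exp (-(t : ℂ) • (𝒢 * (Dᴴ * D) * 𝒢')) =
        𝒢 * NormedSpace.exp (-(t : ℂ) • (Dᴴ * D)) * 𝒢' := by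
      rw [Matrix.mul_assoc, ← Matrix.mul_smul, ← Matrix.smul_mul, ← Matrix.mul_assoc]
      exact Matrix.exp_units_conj ⟨𝒢, 𝒢', h2, h1⟩ _
    rw [hD, hHam, hexp]
    set E := NormedSpace.exp (-(t : ℂ) • (Dᴴ * D))
    -- on the colour block at `(x, α)` the conjugation by `𝒢` is the conjugation by `ρ (g x)`
    have htr : ∑ a : Fin 3, (𝒢 * E * 𝒢') (x, a, α) (x, a, α) =
        (ρ (g x) * Matrix.of (fun b c : Fin 3 => E (x, b, α) (x, c, α)) * ρ (g x)⁻¹).trace := by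
      simp only [h𝒢def, h𝒢'def, mul_gaugeRotation_apply, gaugeRotation_mul_apply, Pi.inv_apply,
        Finset.sum_mul]
      simp only [Matrix.trace, Matrix.diag, Matrix.mul_apply, Matrix.of_apply, Finset.sum_mul]
    rw [htr, Matrix.trace_mul_cycle, ← map_mul, inv_mul_cancel, map_one, Matrix.one_mul]
    simp only [Matrix.trace, Matrix.diag, Matrix.of_apply]
  · rw [plaquetteHolonomy_gaugeTransform, map_mul, map_mul, Matrix.trace_mul_cycle, ← map_mul,
      inv_mul_cancel, map_one, Matrix.one_mul]

end Summit.QuantumFields.QCD.Cruxes.SmallFieldUltracontractivity.PointCentredAxialParabolic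

end
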